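/-
Copyright (c) 2026 the pub-hodgecm-mathlib formalisation cell (harness21).  Prover seat hodgecm-mathlib-LH4-p08 (g2), req620 Track A «(D-RAM) FOUR-FRAME» squad, unit U2H_HSide:
(ρ) child (b′) «H-SIDE DEPTH IDENTITY» (dealer LH4-plan (g10) WORD #45 (1)), brick (b′-0) «ELLIPTICITY FROM DISTINCT NORM-ONE ROOTS» (self-cut by the (b′) holder,
CENSUS `F0/P3c/LH4/LH4-p08/g2/CENSUS-U2H-bprime-p08.v1.LH4p08g2.md`).  2026-09-03.
-/
import Literature.NumberTheory.Rogawski1990.LocalHyperbolicClassIsLevi   -- ★ (E3) the converse direction; brings `conjLocal_apply_eq_galAdicCompletionMap`, `local_eq_unitaryGroupOfForm_map`, the carriers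
import HarnessLib

/-!
# Distinct norm-one eigenvalues are ELLIPTIC: a rank-2 local unitary element whose characteristic polynomial at a non-split place has two distinct roots, one of norm one,
# is NOT `H_v`-conjugate to the diagonal torus (converse of ★ `forall_conjLocal_mul_eq_one_of_not_exists_conj_glDiagonal`; Rogawski 1990 §3.5–§3.6)

Topic `NumberTheory/Rogawski1990`; namespace `Literature.NumberTheory.Rogawski1990`.  THEOREMS ONLY (no definition, no instance, no notation, no named fact, no `sorry`;
count-neutral, lane `--supports stmt-HodgeConjecture-24833 --as helper`).  Cell `pub/hodgecm-mathlib` (D-0151), crux H413, road «(D-RAM) FOUR-FRAME», unit U2H (ii-H), rows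
socket (ρ) `stub_U2H_rowsR_hFamily_unit0`, child (b′): the (b′) target (p06 text 335041993678acc8) binds the H-side element `γ_H` only through the ROOTS `z·a², z·b²` at `w` of the
characteristic polynomial of `γ_H.1` with `a, b, z` of norm one and a finite depth `n₃ = ord_w(a² − b²)` — NO ellipticity binder — whereas every H-side engine consumes
ELLIPTICITY `hell : ¬ ∃ y d′, glDiagonal 2 d′ = (y γ_H y⁻¹).1` (★ p855077 `stableOrbitalIntegralRel_hFamily_eq_mul_of_depth`, ★ p855495 (b′-1)
`stableOrbitalIntegralRel_indicator_prod_top_eq_mul_add_of_typeOne`).  This file supplies `hell` from those binders.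

THE MATHEMATICS.  `H_v = U(Φ₂)_v × U(Φ₁)_v` at a non-split place `v` (`w ∣ v`, `c • w = w`, so `E_v = L_w` and `(c ⊗ 1)` reads `σ_w` at `w`).  A DIAGONAL element
`diag(δ₀, δ₁)` of `U(σ, Φ₂)` (`Φ₂ = antidiag(1, 1)`) satisfies `σ(δ₀)·δ₁ = 1 = σ(δ₁)·δ₀` (entries `(0,1)`, `(1,0)` of `ᵗσ(g)·Φ₂·g = Φ₂`), so its eigenvalue pair is `{δ, σ(δ)⁻¹}`.
If `y γ_H y⁻¹` has diagonal first component `glDiagonal 2 d′`, the characteristic polynomial of `γ_H.1` at `w` is `(X − δ₀)(X − δ₁)` (conjugation invariance), so a root `α`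
of norm one (`α·σ_w α = 1`, i.e. `σ_w(α)⁻¹ = α`) is one of `δ₀, δ₁` and then the OTHER one is `σ_w(α)⁻¹ = α` too: both roots equal `α`, contradicting a second root `γ ≠ α`.
* §1 `conjLocal_mul_eq_one_of_glDiagonal_mem_local` — the two torus relations of a diagonal element of `U(Φ₂)_v`.
* §2 `charpoly_map_fst_conj_eq` — the `w`-characteristic polynomial of `(y γ_H y⁻¹).1` equals that of `γ_H.1`; `isRoot_charpoly_glDiagonal_map_iff` — roots of `diag(d′)` at `w`.
* §3 HEAD **`not_exists_conj_glDiagonal_of_isRoot_of_norm_one`** — `α ≠ γ` roots at `w`, `α·σ_w α = 1` ⇒ `¬ ∃ y d′, glDiagonal 2 d′ = (y γ_H y⁻¹).1`.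
HONEST LABEL: HC_CM is proved only modulo the 7 printed citations (2 remaining named inputs: hLiu418 = `stmt-HodgeConjecture-24832`, h413 = `stmt-HodgeConjecture-24833`) until rung 0
closes; elementary hermitian linear algebra here, nothing printed is asserted.

## References
* [Rogawski1990] J. D. Rogawski, *Automorphic Representations of Unitary Groups in Three Variables*, Ann. of Math. Stud. 123 (1990), §3.5 p. 29 (the tori of `U(2)`: `E¹ × E¹`
  elliptic vs `E^×` in the Levi), §3.6 p. 31.
* [Flicker1998UnitaryFL] Y. Z. Flicker, *Elementary proof of the fundamental lemma for a unitary group*, Canad. J. Math. 50 (1998), §6 p. 95 (`T_H = (E¹)²`).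
-/

set_option autoImplicit false

noncomputable section

open Matrix Polynomial NumberField IsDedekindDomain
open scoped MatrixGroups

namespace Literature.NumberTheory.Rogawski1990

open Literature.AlgebraicGeometry.ShimuraVarieties Literature.NumberTheory.Automorphic Literature.NumberTheory.Automorphic.UnitaryGroup
open Literature.NumberTheory.GaloisRepresentations

section CM

variable (L : Type) [Field L] [NumberField L] [IsCMField L] (v : HeightOneSpectrum (𝓞 ↥(maximalRealSubfield L)))
  (w : PlacesOver L v) (hw : IsCMField.complexConj L • w.1 = w.1)

omit [IsCMField L] in
/-- The local form of `Φ₂` over `E_v` is the literal `antidiag(1, 1)` (as in ★ `LocalHyperbolicClassIsLevi`, where it is private). [cite: Rogawski1990, §3.5 p. 29] -/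
private theorem antidiagTwo_map_algebraMap'' :
    (Matrix.of fun i j : Fin 2 => if i.val + j.val + 1 = 2 then (1 : L) else 0).map (algebraMap L (LocalRing L v)) =
      Matrix.of fun i j : Fin 2 => if i.val + j.val + 1 = 2 then (1 : LocalRing L v) else 0 := by
  ext i j
  simp only [map_apply, of_apply]
  split_ifs <;> simp

/-! ## §1 The diagonal torus of `U(Φ₂)_v`: `σ(δ₀)·δ₁ = 1 = σ(δ₁)·δ₀` -/

/-- **Torus relations of a diagonal element of `U(Φ₂)_v`.**  If `glDiagonal 2 d′` is the first component of an element of `H_v = U(Φ₂)_v × U(Φ₁)_v`, then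
`(c ⊗ 1)(d′₀)·d′₁ = 1` and `(c ⊗ 1)(d′₁)·d′₀ = 1` (entries `(0,1)` and `(1,0)` of `ᵗ((c⊗1) g)·Φ₂·g = Φ₂`). [cite: Rogawski1990, §3.5 p. 29] -/
theorem conjLocal_mul_eq_one_of_glDiagonal_mem_local
    (x : (cmDatum L 2 (Matrix.of fun i j : Fin 2 => if i.val + j.val + 1 = 2 then (1 : L) else 0)).Local v) (d' : Fin 2 → (LocalRing L v)ˣ)
    (hx : glDiagonal 2 (LocalRing L v) d' = (x.val : GL (Fin 2) (LocalRing L v))) :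
    conjLocal L (IsCMField.complexConj L) v (d' 0 : LocalRing L v) * (d' 1 : LocalRing L v) = 1 ∧
      conjLocal L (IsCMField.complexConj L) v (d' 1 : LocalRing L v) * (d' 0 : LocalRing L v) = 1 := by
  have h : glDiagonal 2 (LocalRing L v) d' ∈ unitaryGroupOfForm (conjLocal L (IsCMField.complexConj L) v)
      (Matrix.of fun i j : Fin 2 => if i.val + j.val + 1 = 2 then (1 : LocalRing L v) else 0) := by
    rw [hx, ← antidiagTwo_map_algebraMap'' L v, ← local_eq_unitaryGroupOfForm_map]
    exact x.property
  rw [mem_unitaryGroupOfForm_iff, coe_glDiagonal] at h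
  have h01 := congr_fun (congr_fun h 0) 1
  have h10 := congr_fun (congr_fun h 1) 0
  simp [Matrix.mul_apply, Fin.sum_univ_two, Matrix.diagonal, Matrix.of_apply] at h01 h10
  exact ⟨h01, h10⟩

/-! ## §2 Characteristic polynomials at `w`: conjugation invariance, and the diagonal case -/

/-- **The `w`-characteristic polynomial of `(y γ_H y⁻¹).1` is that of `γ_H.1`** (`(y γ y⁻¹).1 = y.1 γ.1 y.1⁻¹`; map to `L_w`; `charpoly (P N P⁻¹) = charpoly N`).
[cite: Rogawski1990, §3.6 p. 31] -/
theorem charpoly_map_fst_conj_eq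
    (γH y : (cmDatum L 2 (Matrix.of fun i j : Fin 2 => if i.val + j.val + 1 = 2 then (1 : L) else 0)).Local v ×
      (cmDatum L 1 (Matrix.of fun i j : Fin 1 => if i.val + j.val + 1 = 1 then (1 : L) else 0)).Local v) :
    ((((y * γH * y⁻¹).1.val : GL (Fin 2) (LocalRing L v)).val.map (Pi.evalRingHom (fun w' : PlacesOver L v => w'.1.adicCompletion L) w))).charpoly =
      ((((γH).1.val : GL (Fin 2) (LocalRing L v)).val.map (Pi.evalRingHom (fun w' : PlacesOver L v => w'.1.adicCompletion L) w))).charpoly := by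
  set f := Pi.evalRingHom (fun w' : PlacesOver L v => w'.1.adicCompletion L) w with hf
  set P : GL (Fin 2) (w.1.adicCompletion L) := Matrix.GeneralLinearGroup.map f (y.1.val : GL (Fin 2) (LocalRing L v)) with hP
  have hval : ((y * γH * y⁻¹).1.val : GL (Fin 2) (LocalRing L v)) = y.1.val * γH.1.val * (y.1.val)⁻¹ := by
    rw [Prod.fst_mul, Prod.fst_inv]
    rfl
  have hmap : (((y * γH * y⁻¹).1.val : GL (Fin 2) (LocalRing L v)).val.map f) =
      P.val * (((γH).1.val : GL (Fin 2) (LocalRing L v)).val.map f) * P.val⁻¹ := by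
    rw [hval, Units.val_mul, Units.val_mul, Matrix.map_mul, Matrix.map_mul, ← Matrix.coe_units_inv, hP]
    congr 1
  rw [hmap, Matrix.charpoly_units_conj]

omit [IsCMField L] in
/-- **Roots of a diagonal element at `w`**: `x` is a root of the `w`-characteristic polynomial of `glDiagonal 2 d′` iff `x = d′₀(w)` or `x = d′₁(w)`. [cite: Rogawski1990, §3.5 p. 29] -/
theorem isRoot_charpoly_glDiagonal_map_iff (d' : Fin 2 → (LocalRing L v)ˣ) (x : w.1.adicCompletion L) :
    (((glDiagonal 2 (LocalRing L v) d' : GL (Fin 2) (LocalRing L v)).val.map (Pi.evalRingHom (fun w' : PlacesOver L v => w'.1.adicCompletion L) w))).charpoly.IsRoot x ↔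
      x = (d' 0 : LocalRing L v) w ∨ x = (d' 1 : LocalRing L v) w := by
  rw [coe_glDiagonal, Matrix.diagonal_map (map_zero _), Matrix.charpoly_diagonal, Fin.prod_univ_two, Polynomial.root_mul, Polynomial.root_X_sub_C,
    Polynomial.root_X_sub_C]
  constructor
  · rintro (h | h)
    · exact Or.inl h.symm
    · exact Or.inr h.symm
  · rintro (h | h)
    · exact Or.inl h.symm
    · exact Or.inr h.symm

/-! ## §3 HEAD — ellipticity from distinct norm-one roots -/

include hw in
/-- **ELLIPTICITY FROM DISTINCT NORM-ONE ROOTS** (converse of ★ (E3) `forall_conjLocal_mul_eq_one_of_not_exists_conj_glDiagonal`).  At a non-split place `v` (`w ∣ v`,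
`c • w = w`), let `γ_H ∈ H_v = U(Φ₂)_v × U(Φ₁)_v` and suppose the `w`-characteristic polynomial of `γ_H.1` has two DISTINCT roots `α ≠ γ` in `L_w` with `α` of NORM ONE
(`α·σ_w(α) = 1`).  Then `γ_H` is NOT `H_v`-conjugate to an element with diagonal `U(Φ₂)`-component: `¬ ∃ y d′, glDiagonal 2 d′ = (y γ_H y⁻¹).1` — the hypothesis `hell` of
★ p855495 ∕ the ellipticity premise of ★ p855077, derived from the root binders of the (b′) target (`α = z·a²`, `γ = z·b²`, `a, b, z ∈ E¹`, `ord_w(a² − b²) < ∞`).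
Proof: a diagonal element of `U(Φ₂)_v` has eigenvalue pair `{δ, σ_w(δ)⁻¹}` (§1); `α` is one of them (§2), hence the other is `σ_w(α)⁻¹ = α`, so `γ = α`.
[cite: Rogawski1990, §3.5 p. 29; §3.6 p. 31] [cite: Flicker1998UnitaryFL, §6 p. 95] -/
theorem not_exists_conj_glDiagonal_of_isRoot_of_norm_one
    {γH : (cmDatum L 2 (Matrix.of fun i j : Fin 2 => if i.val + j.val + 1 = 2 then (1 : L) else 0)).Local v ×
      (cmDatum L 1 (Matrix.of fun i j : Fin 1 => if i.val + j.val + 1 = 1 then (1 : L) else 0)).Local v}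
    {α γ : w.1.adicCompletion L}
    (hα : ((((γH).1.val : GL (Fin 2) (LocalRing L v)).val.map (Pi.evalRingHom (fun w' : PlacesOver L v => w'.1.adicCompletion L) w))).charpoly.IsRoot α)
    (hγ : ((((γH).1.val : GL (Fin 2) (LocalRing L v)).val.map (Pi.evalRingHom (fun w' : PlacesOver L v => w'.1.adicCompletion L) w))).charpoly.IsRoot γ)
    (hαγ : α ≠ γ) (hα1 : α * galAdicCompletionMap (L := L) (IsCMField.complexConj L) hw α = 1) :
    ¬ ∃ (y : (cmDatum L 2 (Matrix.of fun i j : Fin 2 => if i.val + j.val + 1 = 2 then (1 : L) else 0)).Local v ×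
      (cmDatum L 1 (Matrix.of fun i j : Fin 1 => if i.val + j.val + 1 = 1 then (1 : L) else 0)).Local v) (d' : Fin 2 → (LocalRing L v)ˣ),
        glDiagonal 2 (LocalRing L v) d' = ((y * γH * y⁻¹).1.val : GL (Fin 2) (LocalRing L v)) := by
  rintro ⟨y, d', hyd⟩
  -- the roots of `γ_H.1` at `w` are those of `diag(d′)`: `α, γ ∈ {d′₀(w), d′₁(w)}`
  have hchar := charpoly_map_fst_conj_eq L v w γH y
  rw [← hyd] at hchar
  rw [← hchar, isRoot_charpoly_glDiagonal_map_iff] at hα hγ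
  -- the torus relations at `w`: `σ_w(δ₀)·δ₁ = 1`, `σ_w(δ₁)·δ₀ = 1`
  obtain ⟨h01, h10⟩ := conjLocal_mul_eq_one_of_glDiagonal_mem_local L v (y * γH * y⁻¹).1 d' hyd
  have h01w := congr_fun h01 w
  have h10w := congr_fun h10 w
  rw [Pi.mul_apply, conjLocal_apply_eq_galAdicCompletionMap L v w hw, Pi.one_apply] at h01w h10w
  -- `σ_w(α)·α = 1` pins the partner of `α` to `α` itself
  have hσα : galAdicCompletionMap (L := L) (IsCMField.complexConj L) hw α ≠ 0 := fun h0 => by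
    rw [h0, mul_zero] at hα1; exact zero_ne_one hα1
  have key : ∀ δ : w.1.adicCompletion L, galAdicCompletionMap (L := L) (IsCMField.complexConj L) hw α * δ = 1 → δ = α := fun δ hδ => by
    have := congrArg (α * ·) hδ
    simp only [← mul_assoc, hα1, one_mul, mul_one] at this
    exact this
  rcases hα with hα0 | hα1'
  · -- `α = δ₀`, so `δ₁ = α`, hence `γ = α`
    rw [← hα0] at h01w
    have hδ1 : (d' 1 : LocalRing L v) w = α := key _ h01w
    rcases hγ with h | h
    · exact hαγ (hα0.trans h.symm)
    · exact hαγ (by rw [h, hδ1])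
  · -- `α = δ₁`, so `δ₀ = α`, hence `γ = α`
    rw [← hα1'] at h10w
    have hδ0 : (d' 0 : LocalRing L v) w = α := key _ h10w
    rcases hγ with h | h
    · exact hαγ (by rw [h, hδ0])
    · exact hαγ (hα1'.trans h.symm)

end CM

end Literature.NumberTheory.Rogawski1990

end
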